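import Summits.ResolutionOfSingularities.ResolutionOfSingularities.Theorems.EquisingularLiftEquisingularLiftNatPointStep
import Summits.ResolutionOfSingularities.ResolutionOfSingularities.Theorems.EquisingularLiftEquisingularLiftReducedStrictTransformBlowup
import Literature.AlgebraicGeometry.Resolution.BlowupsExistence
import HarnessLib

/-!
# [OURS · L1 W4.5(b) · EL♮] T-TAIL «POINT-RESOLVABLE STRICT TRANSFORMS FINISH THE CHAIN, WITH ANY TRACE-𝔪 CENTRES»
# (the engine of res-L1-w45b-lead-2's rung T-Δ-ISO «one Δ-step then points», TARGETS 2026-08-27T06:52:51Z (3); named to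
# res-D-pv-013 by res-L1-w45b-plan-1 CHAIN v7.1 (B))

Crux `EquisingularLiftNat` = stmt-ResolutionOfSingularities-20038 (route EquisingularLift), line `sections`; helper file
`--supports … --as helper`. HONEST FRAMING: OURS (cell res-hironaka, slot W4.5(b)); NOT a statement of any manuscript; scheme-theoretic
assembly only. AI-written, weaker than expert review. No `sorry`; standard axioms.

WHAT. res-D-pv-029's T-ISO-0 (p505885) lifts a DOWNSTAIRS chain of point blow-ups to an UPSTAIRS horizontal-E1 chain of blow-ups
along Hensel SECTIONS, carrying only an isomorphism «downstairs reduced strict transform ≅ upstairs reduced strict transform»; it needs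
good reduction of the running ambient at every special point (sections exist only there). After a Δ-step (a curve centre inside a
point-carrier whose special fibre is a SINGULAR plane curve) the ambient acquires BAD points, and the device of record there is
lead-2's RAMIFIED MULTISECTION (MEMO-2 v1.3 §7, target T-MULTISEC, res-D-pv-003): a regular `O`-flat centre `C` with special-fibre
trace the point `b` AND ideal-theoretic trace `C · 𝒪_Γ = 𝔪_{Γ,b}` on the running reduced strict transform `Γ`. This file proves the
tail induction ONCE for ANY such device, abstractly:

* `horizChainE1_of_pointResolvable` — SETTING of `pointStep` (p505032): `O` a DVR, `q : P → Spec O` smooth proper, `Y ⊆ q⁻¹{s₀}`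
  closed irreducible, `Ch` a stage predicate closed under HORIZONTAL E1 steps and implying the item's chain predicate. PARAMETER
  `Adm Γ x` («the point `x` of `Γ` admits the device»; iso-invariant). HYPOTHESIS (MS) «the device»: at every stage `(X', σ', S')`
  with `Ch`, for every point `z` of `Γ' = V(closure S')_red` closed in `X'`, non-regular and admissible, there is `C : X'.IdealSheafData`
  with `V(C)` regular, `V(C) → Spec O` flat, `supp C ∩ special fibre = {z}` and TRACE `C · 𝒪_{Γ'} = 𝓘_{z}` (as ideal sheaves of `Γ'`).
  HYPOTHESIS (DOWN): an abstract scheme `Γ ≅ Γ'` is POINT-RESOLVABLE — some regular `Γ*` lies in the inductive closure of `Γ` under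
  blow-ups `Γ₂ → Γ₁` at closed, non-regular, admissible points. CONCLUSION: some stage `(X₁, σ₁, S₁)` with `Ch` has REGULAR
  `V(closure S₁)_red`. PROOF: induction along (DOWN) carrying «some `Ch`-stage has reduced strict transform `≅ Γᵢ`»; the step takes
  the (MS) centre through the point corresponding to `x`, checks the step clauses (E1: the trace point lies in `S'`; off-generic: a
  non-regular point is not the generic point, `Split.Chain.fibre`), blows up (`exists_isBlowup`), and identifies the new reduced
  strict transform — a blow-up of `Γ'` along the trace `C · 𝒪_{Γ'} = 𝓘_{z}` by the strict-transform theorem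
  (`StrataSplit.exists_isBlowup_reducedStrictTransform`, p167331, Stacks 080E) — with `Γ₂` by uniqueness of blow-ups (`isBlowup_comp_iso_vanishingIdeal_singleton`, p504357, and `IsBlowup.unique`).

Consumers: `…NatDeltaIso.lean` (T-Δ-ISO: two explicit steps — section, Δ-centre — then this tail) and lead-2's T-ISO-2
(«surface point blow-ups are admissible anywhere»: stage 0 + this tail, once T-MULTISEC discharges (MS) with `Adm` = «embedding
dimension ≤ 3»).

References: Theorems/…NatPointStep.lean (p505032), …NatPointResolution.lean (p505885), …ReducedStrictTransformBlowup.lean (p167331);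
The Stacks Project, Tag 080E; res-L1-w45b-lead-2 MEMO-2 v1.3 §7 / TARGETS 06:52:51Z — OURS planning texts, index only.
-/

set_option linter.dupNamespace false -- mandated namespace `Summit.<Summit>.<Problem>` of this single-conjunct summit
set_option linter.overlappingInstances false -- signatures carry `[IsDomain O] [IsDiscreteValuationRing O]`

noncomputable section

open CategoryTheory CategoryTheory.Limits AlgebraicGeometry TopologicalSpace Topology
open Literature.AlgebraicGeometry.Resolution
open AlgebraicGeometry.Scheme.IdealSheafData
open Summit.ResolutionOfSingularities.ResolutionOfSingularities.Theses.EquisingularLift.Split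
open Summit.ResolutionOfSingularities.ResolutionOfSingularities.Cruxes.EquisingularLift.StrataSplit

namespace Summit.ResolutionOfSingularities.ResolutionOfSingularities.Cruxes.EquisingularLiftNat.Sections

universe u

/-! ## The tail induction -/

/-- **T-TAIL «POINT-RESOLVABLE STRICT TRANSFORMS FINISH THE CHAIN».** In the setting of `pointStep` (p505032) let `Adm` be an
iso-invariant predicate on points of schemes and assume the DEVICE (MS): at every `Ch`-stage `(X', σ', S')` (locally Noetherian,
regular, proper over `O`), through every point `z` of `Γ' = V(closure S')_red` that is closed in `X'`, non-regular and admissible, there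
is an ideal sheaf `C` on `X'` with `V(C)` regular and flat over `Spec O`, `supp C ∩ q'⁻¹{s₀} = {z}` and trace `C · 𝒪_{Γ'} = 𝓘_{z}`.
If the reduced strict transform of the stage `(X', σ', S')` is isomorphic to a scheme `Γ` that is POINT-RESOLVABLE (some regular `Γ*` is
reached from `Γ` by blow-ups at closed non-regular admissible points), then some `Ch`-stage has regular reduced strict transform.
[folklore; the induction of T-ISO-0 p505885 with the section replaced by an abstract trace-`𝔪` centre] -/
theorem horizChainE1_of_pointResolvable (O : Type) [CommRing O] [IsDomain O] [IsDiscreteValuationRing O]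
    (P : Scheme.{0}) (q : P ⟶ Spec (.of O)) (Y : Closeds P)
    (Ch : ∀ X' : Scheme.{0}, (X' ⟶ P) → Set X' → Prop)
    (hChain : ∀ (X' : Scheme.{0}) (σ : X' ⟶ P) (S : Set X'), Ch X' σ S → Chain P (Y : Set P) X' σ S)
    (hStep : ∀ (X' X'' : Scheme.{0}) (σ' : X' ⟶ P) (S' : Set X') (C : X'.IdealSheafData) (τ : X'' ⟶ X'),
      Ch X' σ' S' → IsBlowup τ C → Scheme.IsRegular C.subscheme → Flat (C.subschemeι ≫ σ' ≫ q) →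
      σ' '' (C.support : Set X') ⊆ {x : P | ¬ IsGenericPoint x (Y : Set P)} →
      (C.support : Set X') ∩ (σ' ≫ q) ⁻¹' {IsLocalRing.closedPoint O} ⊆ S' →
      Ch X'' (τ ≫ σ') (closure (τ ⁻¹' (S' \ (C.support : Set X')))))
    (hq : Smooth q) (hqp : IsProper q)
    (hY : (Y : Set P) ⊆ q ⁻¹' {IsLocalRing.closedPoint O}) (hYirr : IsIrreducible (Y : Set P))
    -- the admissibility predicate of the device and the device
    (Adm : ∀ Γ : Scheme.{0}, Γ → Prop)
    (hAdm : ∀ (Γ Γ' : Scheme.{0}) (e : Γ ≅ Γ') (x : Γ), Adm Γ x → Adm Γ' (e.hom x))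
    (hMS : ∀ (X' : Scheme.{0}) (σ' : X' ⟶ P) (S' : Set X'), Ch X' σ' S' → IsLocallyNoetherian X' →
      Scheme.IsRegular X' → IsProper (σ' ≫ q) →
      ∀ (z : ↥(vanishingIdeal (⟨closure S', isClosed_closure⟩ : Closeds X')).subscheme),
        IsClosed ({((vanishingIdeal (⟨closure S', isClosed_closure⟩ : Closeds X')).subschemeι z : X')} : Set X') →
        ¬ IsRegularLocalRing ((vanishingIdeal (⟨closure S', isClosed_closure⟩ : Closeds X')).subscheme.presheaf.stalk z) →
        Adm _ z →
        ∃ C : X'.IdealSheafData, Scheme.IsRegular C.subscheme ∧ Flat (C.subschemeι ≫ σ' ≫ q) ∧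
          (C.support : Set X') ∩ (σ' ≫ q) ⁻¹' {IsLocalRing.closedPoint O} =
            {((vanishingIdeal (⟨closure S', isClosed_closure⟩ : Closeds X')).subschemeι z : X')} ∧
          ∃ hzc : IsClosed ({z} : Set ↥(vanishingIdeal (⟨closure S', isClosed_closure⟩ : Closeds X')).subscheme),
            C.comap (vanishingIdeal (⟨closure S', isClosed_closure⟩ : Closeds X')).subschemeι = vanishingIdeal ⟨{z}, hzc⟩)
    -- the upstairs stage, the downstairs scheme and their identification
    (X' : Scheme.{0}) (σ' : X' ⟶ P) (S' : Set X') (hCh : Ch X' σ' S')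
    (Γ : Scheme.{0}) (e : Γ ≅ (vanishingIdeal (⟨closure S', isClosed_closure⟩ : Closeds X')).subscheme)
    -- point-resolvability of `Γ`
    (hres : ∃ Γs : Scheme.{0}, (∀ R : Scheme.{0} → Prop, R Γ →
      (∀ (Γ₁ Γ₂ : Scheme.{0}) (x : Γ₁) (hx : IsClosed ({x} : Set Γ₁)) (υ : Γ₂ ⟶ Γ₁), R Γ₁ →
        ¬ IsRegularLocalRing (Γ₁.presheaf.stalk x) → Adm Γ₁ x → IsBlowup υ (vanishingIdeal ⟨{x}, hx⟩) → R Γ₂) → R Γs) ∧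
      Scheme.IsRegular Γs) :
    ∃ (X₁ : Scheme.{0}) (σ₁ : X₁ ⟶ P) (S₁ : Set X₁), Ch X₁ σ₁ S₁ ∧
      Scheme.IsRegular (vanishingIdeal (⟨closure S₁, isClosed_closure⟩ : Closeds X₁)).subscheme := by
  classical
  -- ambient facts
  haveI := hq
  haveI := hqp
  have hPnoeth : IsLocallyNoetherian P := LocallyOfFiniteType.isLocallyNoetherian q
  have hPreg : Scheme.IsRegular P := fun y => (stub_goodAtOfSmooth O P q hq y).1
  set s₀ := IsLocalRing.closedPoint O with hs₀def
  obtain ⟨ξ, hξ⟩ : ∃ ξ : P, IsGenericPoint ξ (Y : Set P) := QuasiSober.sober hYirr Y.isClosed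
  -- THE INDUCTION PREDICATE: some `Ch`-stage has reduced strict transform isomorphic to the downstairs scheme
  let QD : Scheme.{0} → Prop := fun Γ₁ => ∃ (X₁ : Scheme.{0}) (σ₁ : X₁ ⟶ P) (S₁ : Set X₁), Ch X₁ σ₁ S₁ ∧
    Nonempty (Γ₁ ≅ (vanishingIdeal (⟨closure S₁, isClosed_closure⟩ : Closeds X₁)).subscheme)
  obtain ⟨Γs, hclos, hregs⟩ := hres
  have hQD : QD Γs := by
    refine hclos QD ⟨X', σ', S', hCh, ⟨e⟩⟩ ?_
    intro Γ₁ Γ₂ x hx υ hQ₁ hxreg hxadm hυ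
    obtain ⟨X₁, σ₁, S₁, hCh₁, ⟨e₁⟩⟩ := hQ₁
    -- invariants of the stage
    have hch₁ : Chain P (Y : Set P) X₁ σ₁ S₁ := hChain _ _ _ hCh₁
    obtain ⟨hnoeth₁, hreg₁, hσ₁⟩ := chain_isRegular P (Y : Set P) X₁ σ₁ S₁ hch₁ hPnoeth hPreg
    haveI := hnoeth₁
    haveI := hσ₁
    set r₁ : X₁ ⟶ Spec (.of O) := σ₁ ≫ q with hr₁
    haveI : IsProper r₁ := inferInstance
    obtain ⟨ξ₁, hfib₁, hS₁⟩ := Chain.fibre hch₁ hξ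
    have hS₁cl : IsClosed S₁ := by rw [hS₁]; exact isClosed_closure
    have hclS₁ : closure S₁ = S₁ := hS₁cl.closure_eq
    have hS₁irr : IsIrreducible (closure S₁) := by
      rw [hS₁, closure_closure]; exact isIrreducible_singleton.closure
    have hS₁sub : closure S₁ ⊆ r₁ ⁻¹' {s₀} := closure_subset_preimage_of_chain q hYirr Y.isClosed hY hch₁
    have hgen₁ : IsGenericPoint ξ₁ (closure S₁) := by rw [isGenericPoint_def, hS₁, closure_closure]
    -- the point to blow up upstairs: `z₁ = e₁ x`, `w₁ = ι z₁`
    set Γ' := (vanishingIdeal (⟨closure S₁, isClosed_closure⟩ : Closeds X₁)).subscheme with hΓ'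
    set ιΓ := (vanishingIdeal (⟨closure S₁, isClosed_closure⟩ : Closeds X₁)).subschemeι with hιΓ
    set z₁ : Γ' := e₁.hom x with hz₁def
    set w₁ : X₁ := ιΓ z₁ with hw₁
    have hz₁reg : ¬ IsRegularLocalRing (Γ'.presheaf.stalk z₁) := fun h =>
      hxreg ((isRegularLocalRing_stalk_iff_of_iso e₁ x).mp h)
    have hz₁adm : Adm Γ' z₁ := hAdm _ _ e₁ x hxadm
    have hrange₁ : Set.range ιΓ = closure S₁ := by
      rw [hιΓ, range_subschemeι, coe_support_vanishingIdeal]; rfl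
    have hw₁mem : w₁ ∈ closure S₁ := (Set.ext_iff.mp hrange₁ _).mp (Set.mem_range_self z₁)
    have hr₁w₁ : r₁ w₁ = s₀ := hS₁sub hw₁mem
    have hw₁gen : ¬ IsGenericPoint w₁ (closure S₁) :=
      not_isGenericPoint_of_not_isRegularLocalRing (⟨closure S₁, isClosed_closure⟩ : Closeds X₁) hS₁irr z₁ hz₁reg
    have hz₁cl : IsClosed ({z₁} : Set Γ') := isClosed_singleton_hom_of_iso e₁ hx
    have hw₁cl : IsClosed ({w₁} : Set X₁) := by
      have h := ιΓ.isClosedEmbedding.isClosedMap _ hz₁cl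
      rwa [Set.image_singleton] at h
    -- the DEVICE: a trace-`𝔪` centre through `w₁`
    obtain ⟨C, hCreg, hCflat, hCspec, hz₁cl', hCtrace⟩ :=
      hMS X₁ σ₁ S₁ hCh₁ hnoeth₁ hreg₁ inferInstance z₁ hw₁cl hz₁reg hz₁adm
    have hCspecial : ∀ c ∈ (C.support : Set X₁), r₁ c = s₀ → c = w₁ := by
      intro c hc hcs
      have hmem : c ∈ (C.support : Set X₁) ∩ r₁ ⁻¹' {s₀} := ⟨hc, hcs⟩
      rw [hr₁, hCspec] at hmem
      exact hmem
    have hξ₁mem : ξ₁ ∈ closure S₁ := by rw [hS₁, closure_closure]; exact subset_closure rfl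
    have hξ₁C : ξ₁ ∉ (C.support : Set X₁) := fun h => hw₁gen (hCspecial ξ₁ h (hS₁sub hξ₁mem) ▸ hgen₁)
    have hnotsub : ¬ closure S₁ ⊆ (C.support : Set X₁) := fun h => hξ₁C (h hξ₁mem)
    -- blow up
    obtain ⟨X₂, τ, hτ⟩ := exists_isBlowup X₁ C
    haveI : IsProper τ := hτ.isProper
    have hnoeth₂ : IsLocallyNoetherian X₂ := LocallyOfFiniteType.isLocallyNoetherian τ
    haveI := hnoeth₂
    -- the step clauses: off-generic and E1
    have hTY : σ₁ '' (C.support : Set X₁) ⊆ {y : P | ¬ IsGenericPoint y (Y : Set P)} := by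
      rintro _ ⟨c, hc, rfl⟩ hgen
      have hcs : r₁ c = s₀ := by
        show (σ₁ ≫ q) c = s₀
        rw [Scheme.Hom.comp_apply]
        exact hY hgen.mem
      have hc' := hCspecial c hc hcs
      have h1 : σ₁ c = ξ := hgen.eq hξ
      have h2 : c = ξ₁ := by
        have : c ∈ σ₁ ⁻¹' {ξ} := h1
        rw [hfib₁] at this
        simpa using this
      exact hw₁gen (h2.symm.trans hc' ▸ hgen₁)
    have hE1 : (C.support : Set X₁) ∩ (σ₁ ≫ q) ⁻¹' {s₀} ⊆ S₁ := by
      rintro c ⟨hc, hcs⟩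
      rw [hCspecial c hc hcs, ← hclS₁]
      exact hw₁mem
    have hCh₂ : Ch X₂ (τ ≫ σ₁) (closure (τ ⁻¹' (S₁ \ (C.support : Set X₁)))) :=
      hStep X₁ X₂ σ₁ S₁ C τ hCh₁ hτ hCreg hCflat hTY hE1
    -- UPSTAIRS: the new reduced strict transform is a blow-up of `Γ'` along the trace, i.e. at `z₁`
    obtain ⟨ρ, -, -, hρ⟩ := exists_isBlowup_reducedStrictTransform X₁ X₂ τ C hτ (closure S₁) isClosed_closure hS₁irr hnotsub
    rw [hCtrace] at hρ
    -- DOWNSTAIRS: `υ ≫ e₁` is a blow-up of `Γ'` at `z₁`; uniqueness of blow-ups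
    have hυ' : IsBlowup (υ ≫ e₁.hom) (vanishingIdeal ⟨{z₁}, hz₁cl'⟩) :=
      isBlowup_comp_iso_vanishingIdeal_singleton hx hυ e₁ hz₁cl'
    obtain ⟨e₂, -, -⟩ := hυ'.unique hρ
    -- rewrite the strict-transform set into the form of the new stage
    have hUp : (⟨closure (τ ⁻¹' (closure S₁ \ (C.support : Set X₁))), isClosed_closure⟩ : Closeds X₂) =
        ⟨closure (closure (τ ⁻¹' (S₁ \ (C.support : Set X₁)))), isClosed_closure⟩ := by
      apply Closeds.ext
      change closure _ = closure (closure _)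
      rw [closure_closure, hclS₁]
    rw [hUp] at e₂
    exact ⟨X₂, τ ≫ σ₁, closure (τ ⁻¹' (S₁ \ (C.support : Set X₁))), hCh₂, ⟨e₂⟩⟩
  -- THE END: transport the downstairs regularity through the isomorphism
  obtain ⟨X₁, σ₁, S₁, hCh₁, ⟨e₁⟩⟩ := hQD
  exact ⟨X₁, σ₁, S₁, hCh₁, Scheme.IsRegular.of_iso e₁.hom hregs⟩

/-! ## rev 2 — the iso-invariant form of (DOWN) and its transport -/

/-- (DOWN) in the original form implies the iso-invariant form. [folklore] -/
theorem pointResolvableInv_of_pointResolvable (Adm : ∀ Γ : Scheme.{0}, Γ → Prop) (Γ : Scheme.{0})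
    (hres : ∃ Γs : Scheme.{0}, (∀ R : Scheme.{0} → Prop, R Γ →
      (∀ (Γ₁ Γ₂ : Scheme.{0}) (x : Γ₁) (hx : IsClosed ({x} : Set Γ₁)) (υ : Γ₂ ⟶ Γ₁), R Γ₁ →
        ¬ IsRegularLocalRing (Γ₁.presheaf.stalk x) → Adm Γ₁ x → IsBlowup υ (vanishingIdeal ⟨{x}, hx⟩) → R Γ₂) → R Γs) ∧
      Scheme.IsRegular Γs) :
    ∃ Γs : Scheme.{0}, (∀ R : Scheme.{0} → Prop, (∀ (X X' : Scheme.{0}), Nonempty (X ≅ X') → R X → R X') → R Γ →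
      (∀ (Γ₁ Γ₂ : Scheme.{0}) (x : Γ₁) (hx : IsClosed ({x} : Set Γ₁)) (υ : Γ₂ ⟶ Γ₁), R Γ₁ →
        ¬ IsRegularLocalRing (Γ₁.presheaf.stalk x) → Adm Γ₁ x → IsBlowup υ (vanishingIdeal ⟨{x}, hx⟩) → R Γ₂) → R Γs) ∧
      Scheme.IsRegular Γs := by
  obtain ⟨Γs, hclos, hreg⟩ := hres
  exact ⟨Γs, fun R _ => hclos R, hreg⟩

/-- **Point-resolvability (iso-invariant form) transports along isomorphisms**: if `Γ ≅ Γ'` and some regular `Γ*` lies in the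
closure of `Γ` under admissible point blow-ups for every iso-invariant predicate, the same `Γ*` works for `Γ'`. [folklore] -/
theorem pointResolvableInv_of_iso (Adm : ∀ Γ : Scheme.{0}, Γ → Prop) {Γ Γ' : Scheme.{0}} (e : Γ ≅ Γ')
    (hres : ∃ Γs : Scheme.{0}, (∀ R : Scheme.{0} → Prop, (∀ (X X' : Scheme.{0}), Nonempty (X ≅ X') → R X → R X') → R Γ →
      (∀ (Γ₁ Γ₂ : Scheme.{0}) (x : Γ₁) (hx : IsClosed ({x} : Set Γ₁)) (υ : Γ₂ ⟶ Γ₁), R Γ₁ →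
        ¬ IsRegularLocalRing (Γ₁.presheaf.stalk x) → Adm Γ₁ x → IsBlowup υ (vanishingIdeal ⟨{x}, hx⟩) → R Γ₂) → R Γs) ∧
      Scheme.IsRegular Γs) :
    ∃ Γs : Scheme.{0}, (∀ R : Scheme.{0} → Prop, (∀ (X X' : Scheme.{0}), Nonempty (X ≅ X') → R X → R X') → R Γ' →
      (∀ (Γ₁ Γ₂ : Scheme.{0}) (x : Γ₁) (hx : IsClosed ({x} : Set Γ₁)) (υ : Γ₂ ⟶ Γ₁), R Γ₁ →
        ¬ IsRegularLocalRing (Γ₁.presheaf.stalk x) → Adm Γ₁ x → IsBlowup υ (vanishingIdeal ⟨{x}, hx⟩) → R Γ₂) → R Γs) ∧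
      Scheme.IsRegular Γs := by
  obtain ⟨Γs, hclos, hreg⟩ := hres
  exact ⟨Γs, fun R hR hΓ' hstep => hclos R hR (hR _ _ ⟨e.symm⟩ hΓ') hstep, hreg⟩

/-- A REGULAR scheme is point-resolvable (empty tail; iso-invariant form) — the case of the first specimens (T-ISO-1 quartic,
`H_F`), where the two explicit steps already resolve. [folklore] -/
theorem pointResolvableInv_of_isRegular (Adm : ∀ Γ : Scheme.{0}, Γ → Prop) (Γ : Scheme.{0}) (hreg : Scheme.IsRegular Γ) :
    ∃ Γs : Scheme.{0}, (∀ R : Scheme.{0} → Prop, (∀ (X X' : Scheme.{0}), Nonempty (X ≅ X') → R X → R X') → R Γ →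
      (∀ (Γ₁ Γ₂ : Scheme.{0}) (x : Γ₁) (hx : IsClosed ({x} : Set Γ₁)) (υ : Γ₂ ⟶ Γ₁), R Γ₁ →
        ¬ IsRegularLocalRing (Γ₁.presheaf.stalk x) → Adm Γ₁ x → IsBlowup υ (vanishingIdeal ⟨{x}, hx⟩) → R Γ₂) → R Γs) ∧
      Scheme.IsRegular Γs :=
  ⟨Γ, fun _ _ h _ => h, hreg⟩

/-- A REGULAR scheme is point-resolvable (empty tail; original form). [folklore] -/
theorem pointResolvable_of_isRegular (Adm : ∀ Γ : Scheme.{0}, Γ → Prop) (Γ : Scheme.{0}) (hreg : Scheme.IsRegular Γ) :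
    ∃ Γs : Scheme.{0}, (∀ R : Scheme.{0} → Prop, R Γ →
      (∀ (Γ₁ Γ₂ : Scheme.{0}) (x : Γ₁) (hx : IsClosed ({x} : Set Γ₁)) (υ : Γ₂ ⟶ Γ₁), R Γ₁ →
        ¬ IsRegularLocalRing (Γ₁.presheaf.stalk x) → Adm Γ₁ x → IsBlowup υ (vanishingIdeal ⟨{x}, hx⟩) → R Γ₂) → R Γs) ∧
      Scheme.IsRegular Γs :=
  ⟨Γ, fun _ h _ => h, hreg⟩

/-- **T-TAIL, iso-invariant form of (DOWN)** (rev 2): as `horizChainE1_of_pointResolvable`, but the inductive-closure property of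
(DOWN) is asked only of predicates `R` INVARIANT UNDER ISOMORPHISM — strictly weaker, and transportable along `Γ ≅ Γ'`
(`pointResolvableInv_of_iso`). Same proof: the induction predicate «some `Ch`-stage has reduced strict transform `≅ Γᵢ`» is
iso-invariant. [folklore] -/
theorem horizChainE1_of_pointResolvableInv (O : Type) [CommRing O] [IsDomain O] [IsDiscreteValuationRing O]
    (P : Scheme.{0}) (q : P ⟶ Spec (.of O)) (Y : Closeds P)
    (Ch : ∀ X' : Scheme.{0}, (X' ⟶ P) → Set X' → Prop)
    (hChain : ∀ (X' : Scheme.{0}) (σ : X' ⟶ P) (S : Set X'), Ch X' σ S → Chain P (Y : Set P) X' σ S)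
    (hStep : ∀ (X' X'' : Scheme.{0}) (σ' : X' ⟶ P) (S' : Set X') (C : X'.IdealSheafData) (τ : X'' ⟶ X'),
      Ch X' σ' S' → IsBlowup τ C → Scheme.IsRegular C.subscheme → Flat (C.subschemeι ≫ σ' ≫ q) →
      σ' '' (C.support : Set X') ⊆ {x : P | ¬ IsGenericPoint x (Y : Set P)} →
      (C.support : Set X') ∩ (σ' ≫ q) ⁻¹' {IsLocalRing.closedPoint O} ⊆ S' →
      Ch X'' (τ ≫ σ') (closure (τ ⁻¹' (S' \ (C.support : Set X')))))
    (hq : Smooth q) (hqp : IsProper q)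
    (hY : (Y : Set P) ⊆ q ⁻¹' {IsLocalRing.closedPoint O}) (hYirr : IsIrreducible (Y : Set P))
    -- the admissibility predicate of the device and the device
    (Adm : ∀ Γ : Scheme.{0}, Γ → Prop)
    (hAdm : ∀ (Γ Γ' : Scheme.{0}) (e : Γ ≅ Γ') (x : Γ), Adm Γ x → Adm Γ' (e.hom x))
    (hMS : ∀ (X' : Scheme.{0}) (σ' : X' ⟶ P) (S' : Set X'), Ch X' σ' S' → IsLocallyNoetherian X' →
      Scheme.IsRegular X' → IsProper (σ' ≫ q) →
      ∀ (z : ↥(vanishingIdeal (⟨closure S', isClosed_closure⟩ : Closeds X')).subscheme),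
        IsClosed ({((vanishingIdeal (⟨closure S', isClosed_closure⟩ : Closeds X')).subschemeι z : X')} : Set X') →
        ¬ IsRegularLocalRing ((vanishingIdeal (⟨closure S', isClosed_closure⟩ : Closeds X')).subscheme.presheaf.stalk z) →
        Adm _ z →
        ∃ C : X'.IdealSheafData, Scheme.IsRegular C.subscheme ∧ Flat (C.subschemeι ≫ σ' ≫ q) ∧
          (C.support : Set X') ∩ (σ' ≫ q) ⁻¹' {IsLocalRing.closedPoint O} =
            {((vanishingIdeal (⟨closure S', isClosed_closure⟩ : Closeds X')).subschemeι z : X')} ∧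
          ∃ hzc : IsClosed ({z} : Set ↥(vanishingIdeal (⟨closure S', isClosed_closure⟩ : Closeds X')).subscheme),
            C.comap (vanishingIdeal (⟨closure S', isClosed_closure⟩ : Closeds X')).subschemeι = vanishingIdeal ⟨{z}, hzc⟩)
    -- the upstairs stage, the downstairs scheme and their identification
    (X' : Scheme.{0}) (σ' : X' ⟶ P) (S' : Set X') (hCh : Ch X' σ' S')
    (Γ : Scheme.{0}) (e : Γ ≅ (vanishingIdeal (⟨closure S', isClosed_closure⟩ : Closeds X')).subscheme)
    -- point-resolvability of `Γ`
    (hres : ∃ Γs : Scheme.{0}, (∀ R : Scheme.{0} → Prop, (∀ (X X' : Scheme.{0}), Nonempty (X ≅ X') → R X → R X') → R Γ →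
      (∀ (Γ₁ Γ₂ : Scheme.{0}) (x : Γ₁) (hx : IsClosed ({x} : Set Γ₁)) (υ : Γ₂ ⟶ Γ₁), R Γ₁ →
        ¬ IsRegularLocalRing (Γ₁.presheaf.stalk x) → Adm Γ₁ x → IsBlowup υ (vanishingIdeal ⟨{x}, hx⟩) → R Γ₂) → R Γs) ∧
      Scheme.IsRegular Γs) :
    ∃ (X₁ : Scheme.{0}) (σ₁ : X₁ ⟶ P) (S₁ : Set X₁), Ch X₁ σ₁ S₁ ∧
      Scheme.IsRegular (vanishingIdeal (⟨closure S₁, isClosed_closure⟩ : Closeds X₁)).subscheme := by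
  classical
  -- ambient facts
  haveI := hq
  haveI := hqp
  have hPnoeth : IsLocallyNoetherian P := LocallyOfFiniteType.isLocallyNoetherian q
  have hPreg : Scheme.IsRegular P := fun y => (stub_goodAtOfSmooth O P q hq y).1
  set s₀ := IsLocalRing.closedPoint O with hs₀def
  obtain ⟨ξ, hξ⟩ : ∃ ξ : P, IsGenericPoint ξ (Y : Set P) := QuasiSober.sober hYirr Y.isClosed
  -- THE INDUCTION PREDICATE: some `Ch`-stage has reduced strict transform isomorphic to the downstairs scheme
  let QD : Scheme.{0} → Prop := fun Γ₁ => ∃ (X₁ : Scheme.{0}) (σ₁ : X₁ ⟶ P) (S₁ : Set X₁), Ch X₁ σ₁ S₁ ∧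
    Nonempty (Γ₁ ≅ (vanishingIdeal (⟨closure S₁, isClosed_closure⟩ : Closeds X₁)).subscheme)
  obtain ⟨Γs, hclos, hregs⟩ := hres
  have hQD : QD Γs := by
    refine hclos QD (fun X X'' hXX'' hX => ?_) ⟨X', σ', S', hCh, ⟨e⟩⟩ ?_
    · obtain ⟨i⟩ := hXX''
      obtain ⟨X₁, σ₁, S₁, hCh₁, ⟨e₁⟩⟩ := hX
      exact ⟨X₁, σ₁, S₁, hCh₁, ⟨i.symm ≪≫ e₁⟩⟩
    intro Γ₁ Γ₂ x hx υ hQ₁ hxreg hxadm hυ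
    obtain ⟨X₁, σ₁, S₁, hCh₁, ⟨e₁⟩⟩ := hQ₁
    -- invariants of the stage
    have hch₁ : Chain P (Y : Set P) X₁ σ₁ S₁ := hChain _ _ _ hCh₁
    obtain ⟨hnoeth₁, hreg₁, hσ₁⟩ := chain_isRegular P (Y : Set P) X₁ σ₁ S₁ hch₁ hPnoeth hPreg
    haveI := hnoeth₁
    haveI := hσ₁
    set r₁ : X₁ ⟶ Spec (.of O) := σ₁ ≫ q with hr₁
    haveI : IsProper r₁ := inferInstance
    obtain ⟨ξ₁, hfib₁, hS₁⟩ := Chain.fibre hch₁ hξ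
    have hS₁cl : IsClosed S₁ := by rw [hS₁]; exact isClosed_closure
    have hclS₁ : closure S₁ = S₁ := hS₁cl.closure_eq
    have hS₁irr : IsIrreducible (closure S₁) := by
      rw [hS₁, closure_closure]; exact isIrreducible_singleton.closure
    have hS₁sub : closure S₁ ⊆ r₁ ⁻¹' {s₀} := closure_subset_preimage_of_chain q hYirr Y.isClosed hY hch₁
    have hgen₁ : IsGenericPoint ξ₁ (closure S₁) := by rw [isGenericPoint_def, hS₁, closure_closure]
    -- the point to blow up upstairs: `z₁ = e₁ x`, `w₁ = ι z₁`
    set Γ' := (vanishingIdeal (⟨closure S₁, isClosed_closure⟩ : Closeds X₁)).subscheme with hΓ'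
    set ιΓ := (vanishingIdeal (⟨closure S₁, isClosed_closure⟩ : Closeds X₁)).subschemeι with hιΓ
    set z₁ : Γ' := e₁.hom x with hz₁def
    set w₁ : X₁ := ιΓ z₁ with hw₁
    have hz₁reg : ¬ IsRegularLocalRing (Γ'.presheaf.stalk z₁) := fun h =>
      hxreg ((isRegularLocalRing_stalk_iff_of_iso e₁ x).mp h)
    have hz₁adm : Adm Γ' z₁ := hAdm _ _ e₁ x hxadm
    have hrange₁ : Set.range ιΓ = closure S₁ := by
      rw [hιΓ, range_subschemeι, coe_support_vanishingIdeal]; rfl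
    have hw₁mem : w₁ ∈ closure S₁ := (Set.ext_iff.mp hrange₁ _).mp (Set.mem_range_self z₁)
    have hr₁w₁ : r₁ w₁ = s₀ := hS₁sub hw₁mem
    have hw₁gen : ¬ IsGenericPoint w₁ (closure S₁) :=
      not_isGenericPoint_of_not_isRegularLocalRing (⟨closure S₁, isClosed_closure⟩ : Closeds X₁) hS₁irr z₁ hz₁reg
    have hz₁cl : IsClosed ({z₁} : Set Γ') := isClosed_singleton_hom_of_iso e₁ hx
    have hw₁cl : IsClosed ({w₁} : Set X₁) := by
      have h := ιΓ.isClosedEmbedding.isClosedMap _ hz₁cl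
      rwa [Set.image_singleton] at h
    -- the DEVICE: a trace-`𝔪` centre through `w₁`
    obtain ⟨C, hCreg, hCflat, hCspec, hz₁cl', hCtrace⟩ :=
      hMS X₁ σ₁ S₁ hCh₁ hnoeth₁ hreg₁ inferInstance z₁ hw₁cl hz₁reg hz₁adm
    have hCspecial : ∀ c ∈ (C.support : Set X₁), r₁ c = s₀ → c = w₁ := by
      intro c hc hcs
      have hmem : c ∈ (C.support : Set X₁) ∩ r₁ ⁻¹' {s₀} := ⟨hc, hcs⟩
      rw [hr₁, hCspec] at hmem
      exact hmem
    have hξ₁mem : ξ₁ ∈ closure S₁ := by rw [hS₁, closure_closure]; exact subset_closure rfl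
    have hξ₁C : ξ₁ ∉ (C.support : Set X₁) := fun h => hw₁gen (hCspecial ξ₁ h (hS₁sub hξ₁mem) ▸ hgen₁)
    have hnotsub : ¬ closure S₁ ⊆ (C.support : Set X₁) := fun h => hξ₁C (h hξ₁mem)
    -- blow up
    obtain ⟨X₂, τ, hτ⟩ := exists_isBlowup X₁ C
    haveI : IsProper τ := hτ.isProper
    have hnoeth₂ : IsLocallyNoetherian X₂ := LocallyOfFiniteType.isLocallyNoetherian τ
    haveI := hnoeth₂
    -- the step clauses: off-generic and E1
    have hTY : σ₁ '' (C.support : Set X₁) ⊆ {y : P | ¬ IsGenericPoint y (Y : Set P)} := by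
      rintro _ ⟨c, hc, rfl⟩ hgen
      have hcs : r₁ c = s₀ := by
        show (σ₁ ≫ q) c = s₀
        rw [Scheme.Hom.comp_apply]
        exact hY hgen.mem
      have hc' := hCspecial c hc hcs
      have h1 : σ₁ c = ξ := hgen.eq hξ
      have h2 : c = ξ₁ := by
        have : c ∈ σ₁ ⁻¹' {ξ} := h1
        rw [hfib₁] at this
        simpa using this
      exact hw₁gen (h2.symm.trans hc' ▸ hgen₁)
    have hE1 : (C.support : Set X₁) ∩ (σ₁ ≫ q) ⁻¹' {s₀} ⊆ S₁ := by
      rintro c ⟨hc, hcs⟩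
      rw [hCspecial c hc hcs, ← hclS₁]
      exact hw₁mem
    have hCh₂ : Ch X₂ (τ ≫ σ₁) (closure (τ ⁻¹' (S₁ \ (C.support : Set X₁)))) :=
      hStep X₁ X₂ σ₁ S₁ C τ hCh₁ hτ hCreg hCflat hTY hE1
    -- UPSTAIRS: the new reduced strict transform is a blow-up of `Γ'` along the trace, i.e. at `z₁`
    obtain ⟨ρ, -, -, hρ⟩ := exists_isBlowup_reducedStrictTransform X₁ X₂ τ C hτ (closure S₁) isClosed_closure hS₁irr hnotsub
    rw [hCtrace] at hρ
    -- DOWNSTAIRS: `υ ≫ e₁` is a blow-up of `Γ'` at `z₁`; uniqueness of blow-ups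
    have hυ' : IsBlowup (υ ≫ e₁.hom) (vanishingIdeal ⟨{z₁}, hz₁cl'⟩) :=
      isBlowup_comp_iso_vanishingIdeal_singleton hx hυ e₁ hz₁cl'
    obtain ⟨e₂, -, -⟩ := hυ'.unique hρ
    -- rewrite the strict-transform set into the form of the new stage
    have hUp : (⟨closure (τ ⁻¹' (closure S₁ \ (C.support : Set X₁))), isClosed_closure⟩ : Closeds X₂) =
        ⟨closure (closure (τ ⁻¹' (S₁ \ (C.support : Set X₁)))), isClosed_closure⟩ := by
      apply Closeds.ext
      change closure _ = closure (closure _)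
      rw [closure_closure, hclS₁]
    rw [hUp] at e₂
    exact ⟨X₂, τ ≫ σ₁, closure (τ ⁻¹' (S₁ \ (C.support : Set X₁))), hCh₂, ⟨e₂⟩⟩
  -- THE END: transport the downstairs regularity through the isomorphism
  obtain ⟨X₁, σ₁, S₁, hCh₁, ⟨e₁⟩⟩ := hQD
  exact ⟨X₁, σ₁, S₁, hCh₁, Scheme.IsRegular.of_iso e₁.hom hregs⟩

end Summit.ResolutionOfSingularities.ResolutionOfSingularities.Cruxes.EquisingularLiftNat.Sections

end
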